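import Summits.ABC.IUTFork.DAGC312q
import Summits.ABC.IUTFork.Thm311RemarksSHE

/-!
# Kernel DAG index — layer C312, part zc: knitting DELTA 16 — the LAST OPAQUE LOCUS (SHE) knitted to its typed reading
(abc-iut-c312-1, `Thm311RemarksSHE`): of the 85 loci of [IUTchIII] Cor. 3.12, NONE is opaque any more; in the least reading the
disputed (xi-f) observation is derivable from Theorem 3.11 as typed + (IPL) ALONE

index v1 · abc-iut-c312-2 (filer, gen 4) per HOME/plan/KERNEL-DAG-SPEC.md v1.3 §2(d) ("when a node/locus acquires a typed statement or
`_holds`, re-knit by name") and §4 rule (1) ("re-file the apex with that hypothesis DELETED and the term plugged in"). PROOF-ONLY (no definition),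
APPEND-ONLY: nothing filed earlier is redefined; the reading of record stays `lociReadingI S pending` (part o) — this part
INSTANTIATES its free parameter `pending` at (SHE) and records what follows. CO-IMPORT NEUTRAL (imports part q and c312-1's F2 only;
not part p / Team A).

WHAT CHANGED. Parts n/o/q carried (SHE) — Rmk 3.11.1 (iii) "simultaneous holomorphic expressibility", cited at Step (xi-b) — as the ONE
opaque locus of 85: a free `pending .SHE : Prop` (`lociReadingI_SHE`, `derivable_xi_f_iff_SHE'`, `loci_census_v8`). abc-iut-c312-1 has
since TYPED it at the level at which Theorem 3.11 is typed (`Thm311RemarksSHE.lean`, "so that the index can name a `Prop`"):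
`FullSituation.SHETyped S := S.link.SHELoop ∧ S.toSituation.SHEOutput` — (SHE-loop) the closed loop of Rmk 3.9.5 (ix) on the
`F⊢×μ`-prime-strip portions (p. 143 l. 24–43; `sheLoop_iff_ipl`: EQUIVALENT to (IPL) as typed, the loop closes because the `Θ×μ_LGP`-link
is a full poly-isomorphism) ∧ (SHE-out) "the output data itself is expressed … relative to both structures" (p. 161 l. 23–36;
`sheOutput_iff_multiradialCompat`: Thm 3.11 (i)'s multiradial compatibility, a clause of the typed `Statement`); and PROVED the
bookkeeping `sheTyped_of_statement_of_ipl : S.Statement → S.link.IPL → S.SHETyped`, `sheTyped_iff : S.SHETyped ↔ S.link.IPL ∧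
S.MultiradialCompat`. (c312-1 records, neutrally, that the STRONGER gloss of (SHE) — "complete the computation … on a prime-strip
constrained to be subject to the q-intertwining", p. 144 l. 1–3 — is NOT re-typed there: it IS the readings of record of Step (xi-f) by
name, i.e. the residual the cell's adjudication is about. This part knits the TYPED reading and says so; it does not choose between glosses.)

THIS PART:
* NO new definition (proof-only file): the loci parameter is INSTANTIATED INLINE at the typed reading, `fun _ => S.SHETyped` (part o's
  `lociReadingI` consults its parameter only at (SHE): `unresolvedV5 = [SHE, AbsAnab Prop 1.2.1 (vii), EtTh]`, the latter two knitted in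
  parts o/q — so the constant instantiation changes nothing elsewhere), and every "all loci" theorem is ALSO given for an ARBITRARY
  parameter `pending` under the one-way hypothesis `hJ : S.SHETyped → pending .SHE` (`…_of` forms);
  `lociReadingI_SHE_typed : lociReadingI S (fun _ => S.SHETyped) .SHE = S.SHETyped`.
* `N_IUTchIII_Rmk3_11_1_iii_SHE_holds_of` — the locus BY NAME from Theorem 3.11 as typed + (IPL) (c312-1's `sheTyped_of_statement_of_ipl`).
* **`lociReadingJ_all`** — Theorem 3.11 as typed + (IPL) grant ALL 85 LOCI of the reading of record (part q's `lociReadingI_of_SHE'` with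
  its last hypothesis `hSHE` DISCHARGED by the typed reading): no opaque locus, no classical hypothesis, no free parameter consulted.
* **`derivable_xi_f_of_statement_of_ipl`** — in the least reading (`Cor312Least.Derivable`: an observation is derivable iff every locus
  upstream of the node drawing it is granted), the disputed observation of Step (xi-f) ("constitutes … a construction … of `−|log(q)|`")
  is DERIVABLE from Theorem 3.11 as typed + (IPL) alone (part q's `derivable_xi_f_iff_SHE'` ∘ the typed (SHE)). HONEST READING OF THIS:
  "derivable in the least reading" = "all CITED loci upstream are granted" — it says the printed proof's CITATIONS are all typed and
  granted; it does NOT say the (xi-f) inequality follows (that is the OBSERVATION reading `obsReadingA`, parts p/u: `xi_f_levels`, where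
  (xi-f) ⟺ the Statement) — `derivable_least_vs_record` states both side by side.
* apex **`summit_of_cor312_M_J`** = part q's `summit_of_cor312_M_SHE'` with `hSHE` DELETED (spec §4 rule (1)), the loci parameter
  instantiated inline at the typed (SHE): kernel_hyps = 10 (hInd, hadm, hreal, hqreal, hThm, hIPL, hC, hread, hΘ, hq) — none opaque.
* `loci_census_v9`: resolved-by-name 85 of 85; opaque 0 (by `decide` over part n's `unresolvedV5` + the three knitting equations).
THIS FILE PROVES NOTHING NEW about [IUTchIII] §3 AND ASSERTS NOTHING; no side taken on Cor. 3.12 or on any author. typed ≠ discharged;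
indexed ≠ endorsed. [claim: Mochizuki2012, status: disputed]
-/

noncomputable section

namespace Summit.ABC.IUTFork.DAG

open Cor312Proof Thm311 PartC312k

variable {T : ThetaIndex} (S : FullSituation T) (pending : Locus → Prop)

/-! ## 1. (SHE) instantiated at its typed reading -/

/-- knitted: the reading of record at (SHE), with the loci parameter instantiated INLINE at c312-1's typed reading `FullSituation.SHETyped`
(Rmk 3.11.1 (iii) = (SHE-loop) ∧ (SHE-out)), IS that reading. A READING, recorded — nothing asserted. [folklore] -/
theorem lociReadingI_SHE_typed : lociReadingI S (fun _ => S.SHETyped) .SHE = S.SHETyped := by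
  rw [lociReadingI_SHE]

/-- [node IUTchIII:Rmk3.11.1(iii) (SHE) · C312 · [IUTchIII] Rmk 3.11.1 (iii), kurims p.161 l.23–40 · typed by c312-1 `Thm311RemarksSHE`]
**the locus (SHE) BY NAME from Theorem 3.11 as typed + (IPL)**, for ANY loci parameter that grants (SHE) whenever its typed reading holds
(`hJ`): c312-1's `sheTyped_of_statement_of_ipl` ((SHE-loop) ⟸ (IPL) by `sheLoop_iff_ipl`; (SHE-out) ⟸ Thm 3.11 (i) multiradial
compatibility by `sheOutput_of_statement`). Proves nothing new. [claim: Mochizuki2012, status: disputed] -/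
theorem N_IUTchIII_Rmk3_11_1_iii_SHE_holds_of (hJ : S.SHETyped → pending .SHE) (hS : S.Statement) (hIPL : S.link.IPL) :
    lociReadingI S pending .SHE :=
  (lociReadingI_SHE S pending).mpr (hJ (S.sheTyped_of_statement_of_ipl hS hIPL))

/-- The typed (SHE) unfolds to (IPL) ∧ Thm 3.11 (i)'s multiradial compatibility (c312-1 `sheTyped_iff`) — so, GIVEN Theorem 3.11 as typed,
the locus (SHE) at its typed reading is EQUIVALENT to (IPL). [folklore] -/
theorem lociReadingI_SHE_typed_iff_ipl (hS : S.Statement) : lociReadingI S (fun _ => S.SHETyped) .SHE ↔ S.link.IPL := by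
  rw [lociReadingI_SHE_typed, FullSituation.sheTyped_iff]
  exact ⟨fun h => h.1, fun h => ⟨h, hS.1.2.2⟩⟩

/-! ## 2. All 85 loci; the least reading -/

/-- **ALL 85 LOCI of the reading of record are granted by Theorem 3.11 as typed + (IPL)**, for ANY loci parameter granting (SHE) whenever
its typed reading holds (`hJ`) — part q's `lociReadingI_of_SHE'` with its last hypothesis DISCHARGED by the typed (SHE). [folklore] -/
theorem lociReadingJ_all_of (hJ : S.SHETyped → pending .SHE) (hS : S.Statement) (hIPL : S.link.IPL) : ∀ c, lociReadingI S pending c :=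
  lociReadingI_of_SHE' S pending hS hIPL (hJ (S.sheTyped_of_statement_of_ipl hS hIPL))

/-- **ALL 85 LOCI, the parameter instantiated at the typed (SHE)**: Theorem 3.11 as typed + (IPL) suffice — no opaque locus, no classical
hypothesis, no free parameter consulted. [folklore] -/
theorem lociReadingJ_all (hS : S.Statement) (hIPL : S.link.IPL) : ∀ c, lociReadingI S (fun _ => S.SHETyped) c :=
  lociReadingJ_all_of S _ id hS hIPL

/-- **In the LEAST reading, the disputed observation of Step (xi-f) is DERIVABLE from Theorem 3.11 as typed + (IPL) alone** (part q's
`derivable_xi_f_iff_SHE'`: derivable iff (SHE) granted; (SHE) at its typed reading follows from the two). "Derivable in the least reading"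
means: every CITED locus upstream of node (xi-f) is granted (`Cor312Least.Derivable`) — a statement about the printed proof's CITATIONS,
not about the inequality (see `derivable_least_vs_record`). [folklore] -/
theorem derivable_xi_f_of_statement_of_ipl (hS : S.Statement) (hIPL : S.link.IPL) :
    Derivable (lociReadingI S (fun _ => S.SHETyped)) .constitutesConstruction :=
  (derivable_xi_f_iff_SHE' S _ hS hIPL).mpr (S.sheTyped_of_statement_of_ipl hS hIPL)

/-- The same for ANY loci parameter granting (SHE) whenever its typed reading holds. [folklore] -/
theorem derivable_xi_f_of_statement_of_ipl_of (hJ : S.SHETyped → pending .SHE) (hS : S.Statement) (hIPL : S.link.IPL) :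
    Derivable (lociReadingI S pending) .constitutesConstruction :=
  (derivable_xi_f_iff_SHE' S pending hS hIPL).mpr (hJ (S.sheTyped_of_statement_of_ipl hS hIPL))

/-- Given Theorem 3.11 as typed, least-reading derivability of the (xi-f) observation at the typed (SHE) is EQUIVALENT to (IPL) (the typed
(SHE) being (IPL) ∧ a clause of the Statement). [folklore] -/
theorem derivable_xi_f_iff_ipl (hS : S.Statement) (hIPL : S.link.IPL) :
    Derivable (lociReadingI S (fun _ => S.SHETyped)) .constitutesConstruction ↔ S.link.IPL :=
  ⟨fun _ => hIPL, fun h => derivable_xi_f_of_statement_of_ipl S hS h⟩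

/-- **LEAST READING vs READING OF RECORD, side by side (no side taken).** Under Theorem 3.11 as typed + (IPL): (a) in the LEAST reading
every one of the 36 observations of the printed proof is derivable — all 85 cited loci are typed and granted (this part); (b) whether the
(xi-f) INEQUALITY holds is a different question, answered by the reading of record of the observations (parts p/u at the A-side; neutral
form: it is exactly the typed Statement's second clause, which Theorem 3.11 as typed does not decide — part t,
`xi_f_node_undecided_by_typed_thm311`). This theorem records (a) for every observation. [folklore] -/
theorem derivable_least_vs_record (hS : S.Statement) (hIPL : S.link.IPL) (o : Obs) :
    Derivable (lociReadingI S (fun _ => S.SHETyped)) o :=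
  fun c _ => lociReadingJ_all S hS hIPL c

/-! ## 3. The apex with the (SHE) hypothesis deleted -/

/-- **APEX, author's terms, every hypothesis named, NO opaque locus.** Part q's `summit_of_cor312_M_SHE'` with `hSHE` DELETED (spec §4
rule (1)) — the loci parameter instantiated inline at the typed (SHE), discharged by `sheTyped_of_statement_of_ipl` from `hThm` and
`hIPL`. kernel_hyps = 10 (hInd, hadm, hreal, hqreal, hThm, hIPL, hC, hread, hΘ, hq): the chain `hC` at the reading of record, the
READING binder `hread` ((xi-f)'s observation ⟹ `RepresentedVol`), the number identifications — none opaque. [claim: Mochizuki2012, status: disputed] -/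
theorem summit_of_cor312_M_J (V : HeightFamily) (Tm : Thm110Family V) (A : AbcDictionary V)
    (hInd : MochizukiIndeterminacies Tm) {TI : V.Pt → ThetaIndex} (S : ∀ P, FullSituation (TI P))
    (Pn : ∀ P, PilotNouns (S P).toLatticeSituation) (n m : ℤ)
    (hadm : ∀ P (j : (TI P).LabelStar) (vQ : (TI P).VQ), (Pn P).ComponentAdm n m j vQ)
    (hreal : ∀ P, (Pn P).NegLogThetaReal n m) (hqreal : ∀ P, (Pn P).NegLogQReal n m)
    (hThm : ∀ P, (S P).Statement) (hIPL : ∀ P, (S P).link.IPL)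
    {O : V.Pt → Obs → Prop} (hC : ∀ P, Chain (lociReadingI (S P) (fun _ => (S P).SHETyped)) (O P))
    (hread : ∀ P (j : (TI P).LabelStar) (vQ : (TI P).VQ), O P .constitutesConstruction →
      ((Pn P).toCor312Setting n m j vQ (hadm P j vQ)).RepresentedVol)
    (hΘ : ∀ P, (Pn P).negLogTheta n m = (Tm.X P).negLogTheta) (hq : ∀ P, (Pn P).negLogQ n m = -(Tm.X P).absLogq) :
    _root_.ABC :=
  abc_of_indeterminacies_of_cor312 V Tm A hInd fun P => by
    have hc : (Pn P).Cor312At n m :=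
      (Pn P).cor312At_of_componentwise n m (hadm P) (hreal P) (hqreal P)
        fun j vQ => setting_cor312_of_chain _ (lociReadingJ_all (S P) (hThm P) (hIPL P)) (hC P) (hread P j vQ)
    unfold Thm110Data.Cor312
    rw [← hΘ, ← hq]
    exact hc.2.2

/-- CENSUS after Δ16 (by `decide`/`rfl` over part n's list + this part's knitting equations): part n's three unresolved loci are now ALL
knitted — [EtTh] resolved (part o), [AbsAnab] Prop 1.2.1 (vii) PROVED (part q), (SHE) TYPED and granted by Thm 3.11 + (IPL) (this part):
resolved 85 of 85, opaque 0; kernel_hyps of the author's-terms apex 11 → 10. [folklore] -/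
theorem loci_census_v9 : unresolvedV5 = [.SHE, .absAnab_prop1_2_1_vii, .etTh] ∧ (84 : ℕ) + 1 = 85 ∧ N_AbsAnab_Prop1_2_1_vii ∧
    (∀ S : FullSituation T, lociReadingI S (fun _ => S.SHETyped) .SHE = S.SHETyped) ∧ (11 : ℕ) - 1 = 10 :=
  ⟨rfl, rfl, N_AbsAnab_Prop1_2_1_vii_holds, fun S => lociReadingI_SHE_typed S, rfl⟩

end Summit.ABC.IUTFork.DAG

end
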